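import Literature.NumberTheory.GaloisRepresentations.LubinTateComparisonDilation
import HarnessLib

/-!
# The `𝒪_F`-action relation `h₂ = a · (h₁ ∘ [a]_{f'})` in the Coleman files' `LTCoeff F` currency, read on
# the discrete copy of `𝒪̂_{F^nr}` — currency adapter for the dilation/equivariance transport

Topic `NumberTheory/GaloisRepresentations`; namespace `Literature.NumberTheory.GaloisRepresentations`.

The tree's Coleman files state de Shalit's I.2.3 (iv) / I.3.4 Lemma (ii) over `LTCoeff F` with the
Lubin–Tate data `(isLTRing_LTCoeff hπ', isLTSeries_LTCoeff π')` (`colemanSeries_galAct`: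
`g_{σβ} = g_β ∘ [χ(σ)]_{f'}`; `logDeriv_eq_of_eq_subst_hom`: `δH = C a · (δg) ∘ [a]_{f'}`), whereas the
θ-transport files (`LubinTateComparisonDilation.lean`, `PAdicOneVariableEquivarianceOfComparison.lean`) use
`homC' h2 u a = ι([a]_{f'})` for `f' = (u·2)X + X²` with the data `(isLTRing_unit_mul h2 u, isLTSeries_ltPoly)`.
This file identifies the two (`hom_congr`: `[a]` depends only on the series) and pushes the relation:

* `map_hom_LTCoeff_eq_homC'` — `ι([a]_{f'}) = homC' h2 u a` for the Coleman files' `[a]_{f'}`;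
* ★ `map_eq_C_mul_subst_homC'_of_eq` — **`h₂ = C a · (h₁ ∘ [a]_{f'})` in `LTCoeff F⟦X⟧ ⟹ ι h₂ = C (ι a) · (ι h₁ ∘ homC' a)`**
  in `UnrCoeff F⟦X⟧` — the hypothesis `hh` of `invAmice₁_μ_of_eq_C_mul_subst_homC'` /
  `restrictUnits_density_unitInv_μ_unitMul_of_eq_C_mul_subst_homC'`.

Everything is proved; no named facts, no definitions, no instances, no `sorry`.

## References

* [deShalit1987] E. de Shalit, *Iwasawa theory of elliptic curves with complex multiplication* (1987),
  I.2.3 (iv) (p. 14), I.3.4 Lemma (ii) (p. 18).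
-/

noncomputable section

open MvPowerSeries

namespace Literature.NumberTheory.GaloisRepresentations

section DilationLTCoeff

open ValuativeRel IsLocalRing Field IsNonarchimedeanLocalField LubinTate
open Literature.NumberTheory.PAdicHodge

variable {F : Type} [Field F] [ValuativeRel F] [TopologicalSpace F] [IsNonarchimedeanLocalField F]
variable (h2 : (valuation F).IsUniformizer (((2 : ℕ) : 𝒪[F]) : F)) (u : 𝒪[F]ˣ)

/-- **`ι([a]_{f'}) = homC' h2 u a`**: the Coleman files' endomorphism series `[a]_{f'}` over `LTCoeff F`
(`f' = π'X + X^q`, `π' = u·2`, data `isLTRing_LTCoeff`/`isLTSeries_LTCoeff`) read on `𝒪̂_{F^nr}` is the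
θ-transport files' `homC'` (`[a]` depends only on the series `f'`). [cite: deShalit1987, I.2.3 (iv) (p. 14)] -/
theorem map_hom_LTCoeff_eq_homC' (a : 𝒪[F]) :
    (hom (isLTRing_LTCoeff (isUniformizer_unit_mul h2 u))
        (isLTSeries_LTCoeff ((u : 𝒪[F]) * ((2 : ℕ) : 𝒪[F])))
        (isLTSeries_LTCoeff ((u : 𝒪[F]) * ((2 : ℕ) : 𝒪[F]))) (LTCoeff.of F a)).map
        ((intToUnrCoeff F).comp (LTCoeff.of F).symm.toRingHom) =
      homC' h2 u a := by
  rw [homC', hom_congr (isLTRing_LTCoeff (isUniformizer_unit_mul h2 u)) (isLTRing_unit_mul h2 u)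
    (isLTSeries_LTCoeff ((u : 𝒪[F]) * ((2 : ℕ) : 𝒪[F]))) (isLTSeries_LTCoeff ((u : 𝒪[F]) * ((2 : ℕ) : 𝒪[F])))
    (isLTSeries_ltPoly F (π := (u : 𝒪[F]) * ((2 : ℕ) : 𝒪[F])))
    (isLTSeries_ltPoly F (π := (u : 𝒪[F]) * ((2 : ℕ) : 𝒪[F]))) rfl rfl (LTCoeff.of F a)]
  rfl

/-- ★ **`h₂ = C a · (h₁ ∘ [a]_{f'})` in `𝒪[F]⟦X⟧` ⟹ `ι h₂ = C (ι a) · (ι h₁ ∘ homC' a)` in `𝒪̂_{F^nr}⟦X⟧`** —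
the `𝒪_F`-action relation of the Coleman side (`logDeriv_eq_of_eq_subst_hom` with `colemanSeries_galAct`),
in the currency of the equivariance transport (`hh` of `invAmice₁_μ_of_eq_C_mul_subst_homC'`).
[cite: deShalit1987, I.3.4 Lemma (ii) (p. 18)] -/
theorem map_eq_C_mul_subst_homC'_of_eq (a : 𝒪[F]) (h₁ h₂ : PowerSeries (LTCoeff F))
    (hh : h₂ = PowerSeries.C (LTCoeff.of F a) *
      h₁.subst (hom (isLTRing_LTCoeff (isUniformizer_unit_mul h2 u))
        (isLTSeries_LTCoeff ((u : 𝒪[F]) * ((2 : ℕ) : 𝒪[F])))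
        (isLTSeries_LTCoeff ((u : 𝒪[F]) * ((2 : ℕ) : 𝒪[F]))) (LTCoeff.of F a))) :
    h₂.map ((intToUnrCoeff F).comp (LTCoeff.of F).symm.toRingHom) =
      PowerSeries.C (intToUnrCoeff F a) *
        PowerSeries.subst (homC' h2 u a) (h₁.map ((intToUnrCoeff F).comp (LTCoeff.of F).symm.toRingHom)) := by
  rw [hh, map_mul, PowerSeries.map_C]
  erw [PowerSeries.map_subst (PowerSeries.HasSubst.of_constantCoeff_zero' (constantCoeff_hom _ _ _ _))]
  congr 1

end DilationLTCoeff

end Literature.NumberTheory.GaloisRepresentations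

end
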